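import Mathlib.Topology.Algebra.Category.ProfiniteGrp.Completion
import Mathlib.Data.ZMod.Basic
import Literature.AnabelianGeometry.AbsoluteAnabelian.FreeProcyclicStructure
import Literature.AnabelianGeometry.AbsoluteAnabelian.FreeProcyclicModel
import HarnessLib

/-!
# Mathlib's profinite completion `Ẑ` of `ℤ` is free procyclic: the bridge between the tree's two `Ẑ`'s

The abc-iut cell carries TWO incarnations of "`Ẑ` = the profinite completion of the group `ℤ`"
([AbsTopI] §0 p. 7; [SemiAnbd] §6 p. 71 "`Ẑ(1)` [i.e., the profinite completion of `ℤ`, Tate twisted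
once]"; [AbsTopIII] Prop. 1.4 (i) p. 31 "`I_x` … is naturally isomorphic to `Ẑ(1)`"):

* Mathlib's `ProfiniteGrp.ProfiniteCompletion.completion (GrpCat.of (Multiplicative ℤ))` — the tree's
  `Literature.AnabelianGeometry.SemiGraphs.ZHat` (abc-iut-L3, `TemperedCurve.inertia_equiv_zHat`) and
  `Literature.IUT.HodgeTheaters.ZHat` (abc-iut-L5/L6: [IUTchI] Lem. 2.7 (v), [IUTchII] Def. 1.1
  `int_iso_ZHat`, `Reconstruction.frobQuot`), both `abbrev`s for this very term;
* abc-iut-L4's INTRINSIC predicate `FundamentalExtension.IsFreeProcyclic` (a dense cyclic subgroup; an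
  open subgroup of every positive index) with its model `Multiplicative (∀ p : Nat.Primes, ℤ_[p])`
  (`isFreeProcyclic_padicProd`, abc-iut-w5-d024) and the STRUCTURE theorem
  `IsFreeProcyclic.exists_continuousMulEquiv_padicProd` (abc-iut-L4-t6).

This proof-only file (no definitions) connects them:

* `isFreeProcyclic_zHatCompletion` — the completion `Ẑ` IS free procyclic (`⟨η(1)⟩ = η(ℤ)` is dense by
  Mathlib's `ProfiniteCompletion.denseRange`; the kernel of the level projection `Ẑ → ℤ/nℤ` is an open
  subgroup of index `n`);
* `ZHatCompletion.isUnit_of_dense_zpowers_ofAdd` — a topological generator of `∏_p ℤ_p` is a unit of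
  that ring; whence the GENERATOR-NORMALISED structure theorem
  `IsFreeProcyclic.exists_continuousMulEquiv_padicProd_apply` (any prescribed topological generator
  `g ↦ 1`) and `ZHatCompletion.exists_continuousMulEquiv_padicProd` (`Ẑ ≃ₜ* ∏_p ℤ_p`, `η(1) ↦ 1`);
* `IsFreeProcyclic.exists_continuousMulEquiv_zHatCompletion_apply` /
  `isFreeProcyclic_iff_nonempty_continuousMulEquiv_zHatCompletion` — a profinite group is free
  procyclic iff it is `≃ₜ*` the completion `Ẑ`, the isomorphism taking any prescribed topological
  generator to `η(1)` (so every "`≅ Ẑ(1)`" hypothesis of one vocabulary is available in the other);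
* `ZHatCompletion.monoidHom_ext_of_continuous`, `ZHatCompletion.exists_continuousMonoidHom_apply_eq` —
  the pointed universal property of `Ẑ` (continuous homomorphisms out of `Ẑ` are determined by, and
  exist for any prescribed, image of `η(1)` in a profinite group), and
  `ZHatCompletion.eq_one_of_pow_eq_one` (`Ẑ` is torsion-free).

Classical profinite group theory [cite: RibesZalesskii2010, Thm 2.7.1]; the locators below point at
the printed sentences these bricks serve. HONEST FRAMING: nothing here bears on [IUTchIII] Cor. 3.12;
typed ≠ proved elsewhere; no side is taken on any disputed claim.
-/

noncomputable section

open CategoryTheory ProfiniteGrp ProfiniteGrp.ProfiniteCompletion Topology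

namespace Literature.AnabelianGeometry.AbsoluteAnabelian

/-- The level-`N` projection is continuous. [cite: RibesZalesskii2010, Thm 2.7.1] -/
theorem ZHatCompletion.continuous_val {G : Type} [Group G] (N : FiniteIndexNormalSubgroup G) :
    Continuous fun x : completion (GrpCat.of G) => x.val N :=
  (continuous_apply N).comp continuous_subtype_val

/-- Every `η(k)`, `k ∈ ℤ`, is the `k`-th power of `η(1)`. [cite: RibesZalesskii2010, Thm 2.7.1] -/
theorem ZHatCompletion.etaFn_ofAdd (k : ℤ) :
    etaFn (GrpCat.of (Multiplicative ℤ)) (Multiplicative.ofAdd k : Multiplicative ℤ) =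
      etaFn (GrpCat.of (Multiplicative ℤ)) (Multiplicative.ofAdd (1 : ℤ) : Multiplicative ℤ) ^ k := by
  change (eta (GrpCat.of (Multiplicative ℤ))).hom (Multiplicative.ofAdd k : Multiplicative ℤ) =
    (eta (GrpCat.of (Multiplicative ℤ))).hom (Multiplicative.ofAdd (1 : ℤ) : Multiplicative ℤ) ^ k
  rw [← map_zpow]
  congr 1
  rw [← ofAdd_zsmul, smul_eq_mul, mul_one]

/-- The image of `ℤ` in `Ẑ` is the cyclic subgroup generated by `η(1)`. [cite: RibesZalesskii2010, Thm 2.7.1] -/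
theorem ZHatCompletion.range_etaFn_subset_zpowers :
    Set.range (etaFn (GrpCat.of (Multiplicative ℤ))) ⊆
      (Subgroup.zpowers
          (etaFn (GrpCat.of (Multiplicative ℤ)) (Multiplicative.ofAdd (1 : ℤ) : Multiplicative ℤ)) :
        Set (completion (GrpCat.of (Multiplicative ℤ)))) := by
  rintro _ ⟨x, rfl⟩
  refine ⟨(Multiplicative.toAdd : Multiplicative ℤ ≃ ℤ) x, ?_⟩
  change etaFn (GrpCat.of (Multiplicative ℤ)) (Multiplicative.ofAdd (1 : ℤ) : Multiplicative ℤ) ^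
      (Multiplicative.toAdd : Multiplicative ℤ ≃ ℤ) x = _
  rw [← ZHatCompletion.etaFn_ofAdd]
  rfl

/-- `⟨η(1)⟩` is dense in `Ẑ`. [cite: RibesZalesskii2010, Thm 2.7.1] -/
theorem ZHatCompletion.dense_zpowers_eta_one :
    Dense (Subgroup.zpowers
        (etaFn (GrpCat.of (Multiplicative ℤ)) (Multiplicative.ofAdd (1 : ℤ) : Multiplicative ℤ)) :
      Set (completion (GrpCat.of (Multiplicative ℤ)))) :=
  (denseRange (GrpCat.of (Multiplicative ℤ))).mono ZHatCompletion.range_etaFn_subset_zpowers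

/-- `Ẑ` has an open subgroup of every positive index `n`: the kernel of `Ẑ ↠ ℤ/nℤ`.
[cite: RibesZalesskii2010, Thm 2.7.1] -/
theorem ZHatCompletion.exists_isOpen_index {n : ℕ} (hn : 0 < n) :
    ∃ H : Subgroup (completion (GrpCat.of (Multiplicative ℤ))),
      IsOpen (H : Set (completion (GrpCat.of (Multiplicative ℤ)))) ∧ H.index = n := by
  haveI : NeZero n := ⟨hn.ne'⟩
  let f : Multiplicative ℤ →* Multiplicative (ZMod n) :=
    (Int.castAddHom (ZMod n) : ℤ →+ ZMod n).toMultiplicative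
  have hf : Function.Surjective f := fun y => by
    obtain ⟨k, hk⟩ := ZMod.intCast_surjective (Multiplicative.toAdd y)
    exact ⟨Multiplicative.ofAdd k, by
      change Multiplicative.ofAdd ((k : ZMod n)) = y
      rw [hk, ofAdd_toAdd]⟩
  haveI : f.ker.FiniteIndex := by
    refine ⟨?_⟩
    rw [Subgroup.index_ker, MonoidHom.range_eq_top.mpr hf]
    haveI : Finite (Multiplicative (ZMod n)) := inferInstance
    exact Nat.card_pos.ne'
  let N : FiniteIndexNormalSubgroup (Multiplicative ℤ) := FiniteIndexNormalSubgroup.ofSubgroup f.ker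
  let π : completion (GrpCat.of (Multiplicative ℤ)) →* Multiplicative ℤ ⧸ N.toSubgroup :=
    MonoidHom.mk' (fun x => (x.val N : Multiplicative ℤ ⧸ N.toSubgroup)) fun _ _ => rfl
  have hπ : Function.Surjective π := by
    rintro ⟨g⟩
    exact ⟨etaFn _ g, rfl⟩
  refine ⟨π.ker, ?_, ?_⟩
  · haveI : DiscreteTopology ((diagram (GrpCat.of (Multiplicative ℤ))).obj N) := ⟨rfl⟩
    have hc : Continuous π := ZHatCompletion.continuous_val N
    have : (π.ker : Set (completion (GrpCat.of (Multiplicative ℤ)))) = π ⁻¹' {1} := by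
      ext x; simp [MonoidHom.mem_ker]
    rw [this]
    exact (isOpen_discrete _).preimage hc
  · rw [Subgroup.index_ker, MonoidHom.range_eq_top.mpr hπ, Subgroup.card_top]
    change Nat.card (Multiplicative ℤ ⧸ f.ker) = n
    rw [← Subgroup.index, Subgroup.index_ker, MonoidHom.range_eq_top.mpr hf, Subgroup.card_top,
      Nat.card_congr (Multiplicative.toAdd : Multiplicative (ZMod n) ≃ ZMod n)]
    exact Nat.card_zmod n

/-- **`Ẑ` (Mathlib's profinite completion of `ℤ`) is free procyclic.**
[cite: MochizukiAbsTopIII2015, Prop 1.4 (i) p.31] -/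
theorem isFreeProcyclic_zHatCompletion :
    FundamentalExtension.IsFreeProcyclic (completion (GrpCat.of (Multiplicative ℤ))) where
  exists_dense_zpowers := ⟨_, ZHatCompletion.dense_zpowers_eta_one⟩
  exists_isOpen_index _ hn := ZHatCompletion.exists_isOpen_index hn


/-! ### Continuous homomorphisms out of `Ẑ` are determined by the image of `η(1)` -/

/-- Two continuous homomorphisms from `Ẑ` to a Hausdorff topological monoid that agree on `η(1)`
are equal (`η(ℤ)` is dense). [cite: RibesZalesskii2010, Thm 2.7.1] -/
theorem ZHatCompletion.monoidHom_ext_of_continuous {M : Type*} [Monoid M] [TopologicalSpace M]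
    [T2Space M] {f₁ f₂ : completion (GrpCat.of (Multiplicative ℤ)) →* M}
    (h₁ : Continuous f₁) (h₂ : Continuous f₂)
    (h : f₁ (etaFn (GrpCat.of (Multiplicative ℤ)) (Multiplicative.ofAdd (1 : ℤ) : Multiplicative ℤ)) =
      f₂ (etaFn (GrpCat.of (Multiplicative ℤ)) (Multiplicative.ofAdd (1 : ℤ) : Multiplicative ℤ))) :
    f₁ = f₂ := by
  let η : Multiplicative ℤ →* completion (GrpCat.of (Multiplicative ℤ)) :=
    (eta (GrpCat.of (Multiplicative ℤ))).hom
  have hη : f₁.comp η = f₂.comp η := MonoidHom.ext_mint h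
  apply MonoidHom.ext
  intro x
  refine congrFun ((denseRange (GrpCat.of (Multiplicative ℤ))).equalizer h₁ h₂ ?_) x
  funext y
  exact DFunLike.congr_fun hη y

/-! ### Topological generators of `∏_p ℤ_p` are units -/

/-- In the compact ring `∏_p ℤ_p`, an element `u` whose multiples `ℤ·u` are dense is a unit: the
continuous map `x ↦ x·u` has compact, hence closed, image containing the dense set `ℤ·u`.
[cite: RibesZalesskii2010, Thm 2.7.1] -/
theorem ZHatCompletion.isUnit_of_dense_zpowers_ofAdd
    {u : ∀ p : Nat.Primes, @PadicInt (p : ℕ) ⟨p.2⟩}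
    (hu : Dense (Subgroup.zpowers (Multiplicative.ofAdd u) :
      Set (Multiplicative (∀ p : Nat.Primes, @PadicInt (p : ℕ) ⟨p.2⟩)))) :
    IsUnit u := by
  let m : (∀ p : Nat.Primes, @PadicInt (p : ℕ) ⟨p.2⟩) →
      (∀ p : Nat.Primes, @PadicInt (p : ℕ) ⟨p.2⟩) := fun x => x * u
  have hm : Continuous m := continuous_id.mul continuous_const
  have hclosed : IsClosed (Set.range m) := (isCompact_range hm).isClosed
  have hsub : (Subgroup.zpowers (Multiplicative.ofAdd u) :
      Set (Multiplicative (∀ p : Nat.Primes, @PadicInt (p : ℕ) ⟨p.2⟩))) ⊆ Set.range m := by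
    rintro _ ⟨k, rfl⟩
    refine ⟨((k : ℤ) : ∀ p : Nat.Primes, @PadicInt (p : ℕ) ⟨p.2⟩), ?_⟩
    change ((k : ℤ) : ∀ p : Nat.Primes, @PadicInt (p : ℕ) ⟨p.2⟩) * u =
      Multiplicative.toAdd ((Multiplicative.ofAdd u) ^ k)
    rw [← zsmul_eq_mul, ← ofAdd_zsmul, toAdd_ofAdd]
  have huniv : (Set.range m) = Set.univ := by
    have h1 : closure (Subgroup.zpowers (Multiplicative.ofAdd u) :
        Set (Multiplicative (∀ p : Nat.Primes, @PadicInt (p : ℕ) ⟨p.2⟩))) ⊆ Set.range m :=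
      closure_minimal hsub hclosed
    rw [hu.closure_eq] at h1
    exact Set.eq_univ_of_univ_subset h1
  obtain ⟨v, hv⟩ : (1 : ∀ p : Nat.Primes, @PadicInt (p : ℕ) ⟨p.2⟩) ∈ Set.range m := by
    rw [huniv]; exact Set.mem_univ _
  exact IsUnit.of_mul_eq_one v (by rw [mul_comm]; exact hv)

/-- Multiplication by a unit of the ring `∏_p ℤ_p` is an automorphism of the topological group
`∏_p ℤ_p` (written multiplicatively), recorded as an existence statement with its defining formula.
[cite: RibesZalesskii2010, Thm 2.7.1] -/
theorem ZHatCompletion.exists_continuousMulEquiv_mulRight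
    (v : (∀ p : Nat.Primes, @PadicInt (p : ℕ) ⟨p.2⟩)ˣ) :
    ∃ m : Multiplicative (∀ p : Nat.Primes, @PadicInt (p : ℕ) ⟨p.2⟩) ≃ₜ*
        Multiplicative (∀ p : Nat.Primes, @PadicInt (p : ℕ) ⟨p.2⟩),
      ∀ x, Multiplicative.toAdd (m x) = Multiplicative.toAdd x * v :=
  ⟨{ toFun := fun x => Multiplicative.ofAdd (Multiplicative.toAdd x * v)
     invFun := fun x => Multiplicative.ofAdd (Multiplicative.toAdd x * ↑v⁻¹)
     left_inv := fun x => by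
       change Multiplicative.ofAdd (Multiplicative.toAdd x * v * ↑v⁻¹) = x
       rw [Units.mul_inv_cancel_right]; rfl
     right_inv := fun x => by
       change Multiplicative.ofAdd (Multiplicative.toAdd x * ↑v⁻¹ * v) = x
       rw [Units.inv_mul_cancel_right]; rfl
     map_mul' := fun x y => by
       change Multiplicative.ofAdd ((Multiplicative.toAdd x + Multiplicative.toAdd y) * v) = _
       rw [add_mul]; rfl
     continuous_toFun := by
       apply continuous_ofAdd.comp
       exact continuous_toAdd.mul continuous_const
     continuous_invFun := by
       apply continuous_ofAdd.comp
       exact continuous_toAdd.mul continuous_const },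
    fun _ => rfl⟩

/-! ### The structure theorem with a PRESCRIBED generator -/

section Structure

universe u

variable {G : Type u} [Group G] [TopologicalSpace G] [IsTopologicalGroup G]

/-- **Structure theorem, generator-normalised form.** A compact Hausdorff totally disconnected free
procyclic group is isomorphic to `∏_p ℤ_p` by an isomorphism of topological groups taking ANY given
topological generator `g` to `1` (the image of `g` under some isomorphism is a topological generator
of `∏_p ℤ_p`, hence a unit of that ring; compose with multiplication by its inverse).
[cite: MochizukiAbsTopIII2015, Prop 1.4 (i) p.31] -/
theorem FundamentalExtension.IsFreeProcyclic.exists_continuousMulEquiv_padicProd_apply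
    [CompactSpace G] [T2Space G] [TotallyDisconnectedSpace G]
    (h : FundamentalExtension.IsFreeProcyclic G) {g : G} (hg : Dense (Subgroup.zpowers g : Set G)) :
    ∃ e : G ≃ₜ* Multiplicative (∀ p : Nat.Primes, @PadicInt (p : ℕ) ⟨p.2⟩),
      Multiplicative.toAdd (e g) = 1 := by
  obtain ⟨e, -, -, -⟩ := h.exists_continuousMulEquiv_padicProd
  have hu : Dense (Subgroup.zpowers (Multiplicative.ofAdd (Multiplicative.toAdd (e g))) :
      Set (Multiplicative (∀ p : Nat.Primes, @PadicInt (p : ℕ) ⟨p.2⟩))) :=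
    dense_zpowers_map_continuousMulEquiv e hg
  obtain ⟨m, hm⟩ := ZHatCompletion.exists_continuousMulEquiv_mulRight
    (ZHatCompletion.isUnit_of_dense_zpowers_ofAdd hu).unit⁻¹
  refine ⟨e.trans m, ?_⟩
  change Multiplicative.toAdd (m (e g)) = 1
  rw [hm]
  exact (ZHatCompletion.isUnit_of_dense_zpowers_ofAdd hu).mul_val_inv

end Structure

/-! ### `Ẑ` (the completion) versus `∏_p ℤ_p`, and free procyclic groups versus `Ẑ` -/

/-- **`Ẑ ≅ ∏_p ℤ_p`**: Mathlib's profinite completion of `ℤ` is isomorphic, as a topological group,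
to `∏_p ℤ_p` (written multiplicatively), with `η(1) ↦ 1`. [cite: RibesZalesskii2010, Thm 2.7.1] -/
theorem ZHatCompletion.exists_continuousMulEquiv_padicProd :
    ∃ e : completion (GrpCat.of (Multiplicative ℤ)) ≃ₜ*
        Multiplicative (∀ p : Nat.Primes, @PadicInt (p : ℕ) ⟨p.2⟩),
      Multiplicative.toAdd
        (e (etaFn (GrpCat.of (Multiplicative ℤ)) (Multiplicative.ofAdd (1 : ℤ) : Multiplicative ℤ))) =
          1 :=
  isFreeProcyclic_zHatCompletion.exists_continuousMulEquiv_padicProd_apply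
    ZHatCompletion.dense_zpowers_eta_one

section ToZHat

universe u

variable {G : Type u} [Group G] [TopologicalSpace G] [IsTopologicalGroup G]

/-- **A free procyclic profinite group is `≃ₜ* Ẑ`, any topological generator going to `η(1)`.**
[cite: MochizukiAbsTopIII2015, Prop 1.4 (i) p.31] -/
theorem FundamentalExtension.IsFreeProcyclic.exists_continuousMulEquiv_zHatCompletion_apply
    [CompactSpace G] [T2Space G] [TotallyDisconnectedSpace G]
    (h : FundamentalExtension.IsFreeProcyclic G) {g : G} (hg : Dense (Subgroup.zpowers g : Set G)) :
    ∃ e : G ≃ₜ* completion (GrpCat.of (Multiplicative ℤ)),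
      e g = etaFn (GrpCat.of (Multiplicative ℤ)) (Multiplicative.ofAdd (1 : ℤ) : Multiplicative ℤ) := by
  obtain ⟨eG, heG⟩ := h.exists_continuousMulEquiv_padicProd_apply hg
  obtain ⟨eZ, heZ⟩ := ZHatCompletion.exists_continuousMulEquiv_padicProd
  refine ⟨eG.trans eZ.symm, ?_⟩
  change eZ.symm (eG g) = _
  rw [ContinuousMulEquiv.symm_apply_eq]
  exact (Multiplicative.toAdd.injective (heG.trans heZ.symm))

/-- **A free procyclic profinite group is `≃ₜ* Ẑ`.** [cite: MochizukiAbsTopIII2015, Prop 1.4 (i) p.31] -/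
theorem FundamentalExtension.IsFreeProcyclic.nonempty_continuousMulEquiv_zHatCompletion
    [CompactSpace G] [T2Space G] [TotallyDisconnectedSpace G]
    (h : FundamentalExtension.IsFreeProcyclic G) :
    Nonempty (G ≃ₜ* completion (GrpCat.of (Multiplicative ℤ))) := by
  obtain ⟨g, hg⟩ := h.exists_dense_zpowers
  obtain ⟨e, -⟩ := h.exists_continuousMulEquiv_zHatCompletion_apply hg
  exact ⟨e⟩

/-- **`IsFreeProcyclic G ↔ G ≃ₜ* Ẑ`** for a profinite group `G`: the tree's intrinsic predicate for
"`≅ Ẑ`" (abc-iut-L4-t1) is equivalent to being isomorphic, as a topological group, to Mathlib's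
profinite completion of `ℤ` (the tree's `SemiGraphs.ZHat` / `IUT.HodgeTheaters.ZHat`).
[cite: MochizukiAbsTopIII2015, Prop 1.4 (i) p.31] -/
theorem FundamentalExtension.isFreeProcyclic_iff_nonempty_continuousMulEquiv_zHatCompletion
    [CompactSpace G] [T2Space G] [TotallyDisconnectedSpace G] :
    FundamentalExtension.IsFreeProcyclic G ↔
      Nonempty (G ≃ₜ* completion (GrpCat.of (Multiplicative ℤ))) :=
  ⟨fun h => h.nonempty_continuousMulEquiv_zHatCompletion,
    fun ⟨e⟩ => isFreeProcyclic_zHatCompletion.of_continuousMulEquiv e.symm⟩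

omit [IsTopologicalGroup G] in
/-- Transport in the other direction: anything `≃ₜ* Ẑ` is free procyclic (no compactness needed).
[cite: MochizukiAbsTopIII2015, Prop 1.4 (i) p.31] -/
theorem FundamentalExtension.IsFreeProcyclic.of_continuousMulEquiv_zHatCompletion
    (e : G ≃ₜ* completion (GrpCat.of (Multiplicative ℤ))) : FundamentalExtension.IsFreeProcyclic G :=
  isFreeProcyclic_zHatCompletion.of_continuousMulEquiv e.symm

end ToZHat


/-! ### The universal property of `Ẑ` in pointed form, and torsion-freeness -/

/-- **Pointed universal property of `Ẑ` (existence).** For every profinite group `P` and `g ∈ P` there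
is a continuous homomorphism `Ẑ → P` with `η(1) ↦ g` (Mathlib's `ProfiniteCompletion.lift` of
`ℤ → P`, `1 ↦ g`); it is unique by `ZHatCompletion.monoidHom_ext_of_continuous`.
[cite: RibesZalesskii2010, Thm 2.7.1] -/
theorem ZHatCompletion.exists_continuousMonoidHom_apply_eq {P : Type} [Group P] [TopologicalSpace P]
    [IsTopologicalGroup P] [CompactSpace P] [TotallyDisconnectedSpace P] (g : P) :
    ∃ f : completion (GrpCat.of (Multiplicative ℤ)) →ₜ* P,
      f (etaFn (GrpCat.of (Multiplicative ℤ)) (Multiplicative.ofAdd (1 : ℤ) : Multiplicative ℤ)) = g := by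
  let φ : GrpCat.of (Multiplicative ℤ) ⟶ GrpCat.of (ProfiniteGrp.of P) :=
    GrpCat.ofHom (zpowersHom P g)
  refine ⟨(lift φ).hom, ?_⟩
  have h := ConcreteCategory.congr_hom (lift_eta φ) (Multiplicative.ofAdd (1 : ℤ) : Multiplicative ℤ)
  have h2 : φ (Multiplicative.ofAdd (1 : ℤ) : Multiplicative ℤ) = g := by
    change zpowersHom P g (Multiplicative.ofAdd (1 : ℤ)) = g
    rw [zpowersHom_apply, toAdd_ofAdd, zpow_one]
  rw [h2] at h
  exact h

/-- **`Ẑ` is torsion-free**: `x ^ n = 1` with `n ≠ 0` forces `x = 1` (transport from `∏_p ℤ_p`, each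
`ℤ_p` being a domain of characteristic zero). [cite: RibesZalesskii2010, Thm 2.7.1] -/
theorem ZHatCompletion.eq_one_of_pow_eq_one {x : completion (GrpCat.of (Multiplicative ℤ))} {n : ℕ}
    (hn : n ≠ 0) (hx : x ^ n = 1) : x = 1 := by
  obtain ⟨e, -⟩ := ZHatCompletion.exists_continuousMulEquiv_padicProd
  have h1 : Multiplicative.toAdd (e x) = 0 := by
    have h2 : n • Multiplicative.toAdd (e x) = 0 := by
      rw [← toAdd_pow, ← map_pow, hx, map_one, toAdd_one]
    funext p
    have h3 : (n : @PadicInt (p : ℕ) ⟨p.2⟩) * Multiplicative.toAdd (e x) p = 0 := by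
      have := congrFun h2 p
      rwa [Pi.smul_apply, nsmul_eq_mul, Pi.zero_apply] at this
    haveI : Fact (Nat.Prime (p : ℕ)) := ⟨p.2⟩
    rcases mul_eq_zero.mp h3 with h4 | h4
    · exact absurd h4 (Nat.cast_ne_zero.mpr hn)
    · exact h4
  have h5 : e x = 1 := by
    rw [← ofAdd_toAdd (e x), h1]; rfl
  exact e.injective (h5.trans (map_one e).symm)

end Literature.AnabelianGeometry.AbsoluteAnabelian

end
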